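import Mathlib.NumberTheory.ModularForms.Cusps
import HarnessLib

/-!
# Cusp symbols on `P¹(ℚ)`: the boundary map is a homomorphism, and the boundary exact sequence (E-es-29a)

Summit `BirchSwinnertonDyer`, route `ManinLocalTwoThree` (cell bsd-f2-manin), deciding crux C2 `ManinOddAtFour`
(stmt-BirchSwinnertonDyer-22967) and crux C3 `ManinPrimeToThreeAtNine` (stmt-BirchSwinnertonDyer-22968).  The
generation stubs of both active skeleton lines (`stub_multiShiftClass_generation` = E-es-22 on C2,
`stub_shiftClass_generation` = E-es-19 on C3) are reduced (p3: `Theorems/ManinLocalTwoThreeGenerationOfRelativeIhara*.lean`)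
to the relative Ihara statement `Summit.BirchSwinnertonDyer.Rank1Residual.ManinAdditive.RelativeIharaShiftVanishingBar`,
whose proof plan (planner bsd-f2-manin-es, MEMO-es §22–§23) is a calculus of CUSP SYMBOLS: additive functions
`Φ : P¹(ℚ) × P¹(ℚ) → K`, `Φ(a,b) + Φ(b,c) = Φ(a,c)`, with the Möbius action of `GL₂(ℚ)`, the boundary map
`δ_{x₀}Φ(g) = Φ(x₀, g x₀)`, and BOUNDARY symbols `Φ(a,b) = w(b) − w(a)`.

VOCABULARY.  No new definition is introduced: `P¹(ℚ)` with its Möbius action of `GL₂(ℚ)` IS Mathlib's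
`OnePoint ℚ` with `OnePoint.instGLAction` (`g • c`; `OnePoint.smul_infty_eq_ite`, `OnePoint.smul_some_eq_ite` are the
usual formulas `g·∞ = a/c`, `g·x = (a x + b)/(c x + d)`), `SL₂(ℤ) → GL₂(ℚ)` is `Matrix.SpecialLinearGroup.mapGL ℚ`, and
`Γ₀(L)` is Mathlib's `CongruenceSubgroup.Gamma0 L`.  «`Φ` is a symbol» is the hypothesis
`∀ a b c, Φ a b + Φ b c = Φ a c`; «`g` leaves `Φ` invariant» is `∀ a b, Φ (g • a) (g • b) = Φ a b`.

CONTENTS (all elementary; MEMO-es §22.2 «Symbols, lift, discrepancy (E-es-29a)» and §23 «BOTTOM: δΦ is a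
HOMOMORPHISM on G, independent of x₀, zero on every g fixing a cusp»):
* §1 glue: `Φ(a,a) = 0`, `Φ(b,a) = −Φ(a,b)`; the elements of `GL₂(ℚ)` leaving `Φ` invariant are closed under `1`,
  products, inverses, hence contain the subgroup closure of any invariant set
  (`cuspSymbol_invariant_of_mem_closure`); for an invariant `g`, `δ_{x₀}Φ(g h) = δ_{x₀}Φ(g) + δ_{x₀}Φ(h)`
  (`cuspSymbol_delta_mul`), `δ_{x₀}Φ(g)` does not depend on `x₀` (`cuspSymbol_delta_basepoint`), and
  `δ_{x₀}Φ(g) = 0` as soon as `g` fixes one point of `P¹(ℚ)` (`cuspSymbol_delta_eq_zero_of_smul_eq`).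
* §2 E-es-29a, kernel half: a `Γ₀(L)`-invariant symbol with `δ_∞Φ = 0` on `Γ₀(L)` is a boundary symbol,
  `Φ(a,b) = w(b) − w(a)` with `w = Φ(∞, ·)` constant on `Γ₀(L)`-orbits (`exists_boundary_of_delta_eq_zero`).
* §3 E-es-29a, surjectivity half: every additive `φ : Γ₀(L) → K` killing each element of `Γ₀(L)` that fixes a
  point of `P¹(ℚ)` is `δ_∞Φ` for a `Γ₀(L)`-invariant symbol `Φ` (`exists_cuspSymbol_of_parabolic_hom`): choose a
  representative `r` of each `Γ₀(L)`-orbit and a transporter `γ_c r = c`, put `e(c) = φ(γ_c)`; the ambiguity is a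
  stabiliser of `r`, killed by `φ`, so `e(γ c) = e(c) + φ(γ)` and `Φ(a,b) = e(b) − e(a)` works.
Both halves hold for EVERY `L : ℕ` and every additive group `K` (no field, no finiteness).

Nothing here is specific to elliptic curves; nothing about BSD or Manin's conjecture is proved by this file — it
supplies the symbol layer that the relative-Ihara proof (hence the C2/C3 generation stubs) consumes.

References: planner memo HOME/MEMO-es.md §22.2, §23 (cell bsd-f2-manin); es sketch HOME/es/Sketch-es-g10.lean §3
(`SymbolBoundarySequence`, there over an ad-hoc `Cusp := Option ℚ`/`moebius`, here over Mathlib's `OnePoint ℚ`);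
G. Stevens, *Arithmetic on modular curves*, Progr. Math. 20 (1982), Ch. 1–2 (boundary symbols); Ju. I. Manin,
*Parabolic points and zeta functions of modular curves*, Izv. AN SSSR 36 (1972) §1 (symbols `{a,b}`).
-/

set_option autoImplicit false
set_option linter.dupNamespace false

open scoped MatrixGroups

open CongruenceSubgroup Matrix.SpecialLinearGroup

namespace Summit.BirchSwinnertonDyer.BirchSwinnertonDyer.Theorems.ManinLocalTwoThree

/-! ### §1  Glue: symbols, invariance, the boundary map `g ↦ Φ(x₀, g x₀)` -/

section Invariance

variable {K : Type*} (Φ : OnePoint ℚ → OnePoint ℚ → K)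

/-- The identity of `GL₂(ℚ)` leaves every symbol invariant (plumbing). [folklore] -/
theorem cuspSymbol_invariant_one : ∀ a b : OnePoint ℚ, Φ ((1 : GL (Fin 2) ℚ) • a) ((1 : GL (Fin 2) ℚ) • b) = Φ a b :=
  fun a b ↦ by rw [one_smul, one_smul]

/-- Invariance of a symbol is closed under products. [folklore] -/
theorem cuspSymbol_invariant_mul {g h : GL (Fin 2) ℚ} (hg : ∀ a b, Φ (g • a) (g • b) = Φ a b)
    (hh : ∀ a b, Φ (h • a) (h • b) = Φ a b) :
    ∀ a b : OnePoint ℚ, Φ ((g * h) • a) ((g * h) • b) = Φ a b :=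
  fun a b ↦ by rw [mul_smul, mul_smul, hg, hh]

/-- Invariance of a symbol is closed under inverses. [folklore] -/
theorem cuspSymbol_invariant_inv {g : GL (Fin 2) ℚ} (hg : ∀ a b, Φ (g • a) (g • b) = Φ a b) :
    ∀ a b : OnePoint ℚ, Φ (g⁻¹ • a) (g⁻¹ • b) = Φ a b :=
  fun a b ↦ by rw [← hg (g⁻¹ • a) (g⁻¹ • b), smul_inv_smul, smul_inv_smul]

/-- **The invariance group.**  If every element of a set `S ⊆ GL₂(ℚ)` leaves the symbol `Φ` invariant, so does
every element of the subgroup generated by `S` — the set of `g` with `Φ(ga, gb) = Φ(a,b)` is a subgroup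
(MEMO-es §22.4: «let `G_Φ ⊂ PGL₂(ℚ)` be the invariance group of `Φ`»). [folklore] -/
theorem cuspSymbol_invariant_of_mem_closure (S : Set (GL (Fin 2) ℚ))
    (hS : ∀ g ∈ S, ∀ a b, Φ (g • a) (g • b) = Φ a b) {g : GL (Fin 2) ℚ} (hg : g ∈ Subgroup.closure S) :
    ∀ a b : OnePoint ℚ, Φ (g • a) (g • b) = Φ a b := by
  induction hg using Subgroup.closure_induction with
  | mem x hx => exact hS x hx
  | one => exact cuspSymbol_invariant_one Φ
  | mul x y _ _ hx hy => exact cuspSymbol_invariant_mul Φ hx hy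
  | inv x _ hx => exact cuspSymbol_invariant_inv Φ hx

end Invariance

section Glue

variable {K : Type*} [AddCommGroup K] (Φ : OnePoint ℚ → OnePoint ℚ → K)

/-- A symbol vanishes on the diagonal: `Φ(a,a) = 0`. [folklore] -/
theorem cuspSymbol_self (hsym : ∀ a b c, Φ a b + Φ b c = Φ a c) (a : OnePoint ℚ) : Φ a a = 0 := by
  have h := hsym a a a
  exact add_eq_left.mp h

/-- A symbol is antisymmetric: `Φ(b,a) = −Φ(a,b)`. [folklore] -/
theorem cuspSymbol_swap (hsym : ∀ a b c, Φ a b + Φ b c = Φ a c) (a b : OnePoint ℚ) : Φ b a = -Φ a b := by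
  have h := hsym a b a
  rw [cuspSymbol_self Φ hsym a] at h
  exact eq_neg_of_add_eq_zero_right h

/-- **The boundary map is a homomorphism on the invariance group**: for a symbol `Φ`, a base point `x₀`, an
element `g` leaving `Φ` invariant and ANY `h`, `Φ(x₀, g h x₀) = Φ(x₀, g x₀) + Φ(x₀, h x₀)`
(`= Φ(x₀, g x₀) + Φ(g x₀, g h x₀)` and the second term is `Φ(x₀, h x₀)` by invariance).  MEMO-es §23:
«`δΦ(gh) = δΦ(g) + δ(Φ∘g)(h)` — symbols make the Khare glue automatic». [folklore] -/
theorem cuspSymbol_delta_mul (hsym : ∀ a b c, Φ a b + Φ b c = Φ a c) {g : GL (Fin 2) ℚ}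
    (hg : ∀ a b, Φ (g • a) (g • b) = Φ a b) (h : GL (Fin 2) ℚ) (x₀ : OnePoint ℚ) :
    Φ x₀ ((g * h) • x₀) = Φ x₀ (g • x₀) + Φ x₀ (h • x₀) := by
  rw [mul_smul, ← hsym x₀ (g • x₀) (g • h • x₀), hg]

/-- The boundary map at an inverse: `Φ(x₀, g⁻¹ x₀) = −Φ(x₀, g x₀)` for `g` leaving `Φ` invariant. [folklore] -/
theorem cuspSymbol_delta_inv (hsym : ∀ a b c, Φ a b + Φ b c = Φ a c) {g : GL (Fin 2) ℚ}
    (hg : ∀ a b, Φ (g • a) (g • b) = Φ a b) (x₀ : OnePoint ℚ) :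
    Φ x₀ (g⁻¹ • x₀) = -Φ x₀ (g • x₀) := by
  have h := cuspSymbol_delta_mul Φ hsym hg g⁻¹ x₀
  rw [mul_inv_cancel, one_smul, cuspSymbol_self Φ hsym] at h
  exact eq_neg_of_add_eq_zero_right h.symm

/-- **The boundary map does not depend on the base point**: for `g` leaving the symbol `Φ` invariant,
`Φ(x₀, g x₀) = Φ(x₁, g x₁)` (`Φ(x₀,x₁) + Φ(x₁, g x₁) + Φ(g x₁, g x₀)` and the outer terms cancel by invariance).
MEMO-es §22.2 («independent of `x₀`»). [folklore] -/
theorem cuspSymbol_delta_basepoint (hsym : ∀ a b c, Φ a b + Φ b c = Φ a c) {g : GL (Fin 2) ℚ}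
    (hg : ∀ a b, Φ (g • a) (g • b) = Φ a b) (x₀ x₁ : OnePoint ℚ) :
    Φ x₀ (g • x₀) = Φ x₁ (g • x₁) := by
  rw [← hsym x₀ x₁ (g • x₀), ← hsym x₁ (g • x₁) (g • x₀), hg x₁ x₀, cuspSymbol_swap Φ hsym x₀ x₁]
  abel

/-- **The boundary map kills every element fixing a point of `P¹(ℚ)`**: if `g` leaves `Φ` invariant and
`g c = c` for some `c`, then `Φ(x₀, g x₀) = Φ(c, g c) = Φ(c,c) = 0` for every base point.  MEMO-es §22.2 («killing
every `γ` that fixes a cusp») / §23 («zero on every `g` fixing a cusp»). [folklore] -/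
theorem cuspSymbol_delta_eq_zero_of_smul_eq (hsym : ∀ a b c, Φ a b + Φ b c = Φ a c) {g : GL (Fin 2) ℚ}
    (hg : ∀ a b, Φ (g • a) (g • b) = Φ a b) {c : OnePoint ℚ} (hc : g • c = c) (x₀ : OnePoint ℚ) :
    Φ x₀ (g • x₀) = 0 := by
  rw [cuspSymbol_delta_basepoint Φ hsym hg x₀ c, hc, cuspSymbol_self Φ hsym]

end Glue

/-! ### The Möbius action of `Γ₀(L)` through `mapGL ℚ` (plumbing) -/

section Action

variable {L : ℕ}

/-- `(γ γ')·c = γ·(γ'·c)` for `γ, γ' ∈ Γ₀(L)` acting on `P¹(ℚ)` through `mapGL ℚ` (plumbing). [folklore] -/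
theorem gamma0_mul_smul (γ γ' : Gamma0 L) (c : OnePoint ℚ) :
    mapGL ℚ ((γ * γ' : Gamma0 L) : SL(2, ℤ)) • c = mapGL ℚ (γ : SL(2, ℤ)) • mapGL ℚ (γ' : SL(2, ℤ)) • c := by
  rw [Subgroup.coe_mul, map_mul, mul_smul]

/-- `1·c = c` for the unit of `Γ₀(L)` (plumbing). [folklore] -/
theorem gamma0_one_smul (c : OnePoint ℚ) : mapGL ℚ ((1 : Gamma0 L) : SL(2, ℤ)) • c = c := by
  rw [Subgroup.coe_one, map_one, one_smul]

/-- `γ⁻¹·(γ·c) = c` (plumbing). [folklore] -/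
theorem gamma0_inv_smul_smul (γ : Gamma0 L) (c : OnePoint ℚ) :
    mapGL ℚ ((γ⁻¹ : Gamma0 L) : SL(2, ℤ)) • mapGL ℚ (γ : SL(2, ℤ)) • c = c := by
  rw [Subgroup.coe_inv, map_inv, inv_smul_smul]

end Action

/-! ### §2  E-es-29a, kernel half: `δ_∞Φ = 0` on `Γ₀(L)` ⟹ `Φ` is a boundary symbol -/

section Kernel

variable {K : Type*} [AddCommGroup K]

/-- **E-es-29a (ii).**  For every `L` and every additive group `K`: a `Γ₀(L)`-invariant symbol `Φ` on `P¹(ℚ)` whose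
boundary map `γ ↦ Φ(∞, γ∞)` vanishes on `Γ₀(L)` is a BOUNDARY symbol — `Φ(a,b) = w(b) − w(a)` with `w = Φ(∞,·)`
constant on `Γ₀(L)`-orbits (`w(γ a) = Φ(∞, γ∞) + Φ(γ∞, γa) = 0 + Φ(∞, a)`).  MEMO-es §22.2, es sketch
`SymbolBoundarySequence` second conjunct, over Mathlib's `OnePoint ℚ`. [folklore] -/
theorem exists_boundary_of_delta_eq_zero (L : ℕ) (Φ : OnePoint ℚ → OnePoint ℚ → K)
    (hsym : ∀ a b c, Φ a b + Φ b c = Φ a c)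
    (hinv : ∀ γ : Gamma0 L, ∀ a b, Φ (mapGL ℚ (γ : SL(2, ℤ)) • a) (mapGL ℚ (γ : SL(2, ℤ)) • b) = Φ a b)
    (hδ : ∀ γ : Gamma0 L, Φ OnePoint.infty (mapGL ℚ (γ : SL(2, ℤ)) • OnePoint.infty) = 0) :
    ∃ w : OnePoint ℚ → K, (∀ γ : Gamma0 L, ∀ a, w (mapGL ℚ (γ : SL(2, ℤ)) • a) = w a) ∧
      ∀ a b, Φ a b = w b - w a := by
  refine ⟨fun c ↦ Φ OnePoint.infty c, fun γ a ↦ ?_, fun a b ↦ ?_⟩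
  · show Φ OnePoint.infty (mapGL ℚ (γ : SL(2, ℤ)) • a) = Φ OnePoint.infty a
    rw [← hsym OnePoint.infty (mapGL ℚ (γ : SL(2, ℤ)) • OnePoint.infty) (mapGL ℚ (γ : SL(2, ℤ)) • a), hinv, hδ, zero_add]
  · show Φ a b = Φ OnePoint.infty b - Φ OnePoint.infty a
    rw [← hsym OnePoint.infty a b, add_sub_cancel_left]

end Kernel

/-! ### §3  E-es-29a, surjectivity half: a parabolic homomorphism lifts to an invariant symbol -/

section Lift

variable {K : Type*} [AddCommGroup K]

/-- **E-es-29a (i).**  For every `L` and every additive group `K`: an additive map `φ : Γ₀(L) → K` that kills every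
element of `Γ₀(L)` fixing some point of `P¹(ℚ)` is the boundary map `γ ↦ Φ(∞, γ∞)` of a `Γ₀(L)`-invariant symbol
`Φ`.  Construction (MEMO-es §22.2 «define `Φ(c, γc) := φ(γ)` on each orbit, well defined because `φ` kills
stabilisers, extend by base points»): choose a representative `r(c)` of each `Γ₀(L)`-orbit (the same for the whole
orbit) and a transporter `γ_c ∈ Γ₀(L)`, `γ_c r(c) = c`; put `e(c) := φ(γ_c)`; for `γ ∈ Γ₀(L)` the element
`γ_{γc}⁻¹ γ γ_c` fixes `r(c)`, so `e(γ c) = e(c) + φ(γ)`, and `Φ(a,b) := e(b) − e(a)` is a `Γ₀(L)`-invariant symbol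
with `Φ(∞, γ∞) = φ(γ)`.  Es sketch `SymbolBoundarySequence` first conjunct, over Mathlib's `OnePoint ℚ`. [folklore] -/
theorem exists_cuspSymbol_of_parabolic_hom (L : ℕ) (φ : Gamma0 L → K)
    (hφ : ∀ γ γ' : Gamma0 L, φ (γ * γ') = φ γ + φ γ')
    (hpar : ∀ γ : Gamma0 L, ∀ c : OnePoint ℚ, mapGL ℚ (γ : SL(2, ℤ)) • c = c → φ γ = 0) :
    ∃ Φ : OnePoint ℚ → OnePoint ℚ → K, (∀ a b c, Φ a b + Φ b c = Φ a c) ∧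
      (∀ γ : Gamma0 L, ∀ a b, Φ (mapGL ℚ (γ : SL(2, ℤ)) • a) (mapGL ℚ (γ : SL(2, ℤ)) • b) = Φ a b) ∧
      ∀ γ : Gamma0 L, Φ OnePoint.infty (mapGL ℚ (γ : SL(2, ℤ)) • OnePoint.infty) = φ γ := by
  classical
  -- `φ` is a homomorphism: `φ 1 = 0`, `φ γ⁻¹ = -φ γ`
  have φ_one : φ 1 = 0 := by
    have h := hφ 1 1
    rw [mul_one] at h
    exact add_eq_left.mp h.symm
  have φ_inv : ∀ γ : Gamma0 L, φ γ⁻¹ = -φ γ := fun γ ↦ by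
    have h := hφ γ⁻¹ γ
    rw [inv_mul_cancel, φ_one] at h
    exact eq_neg_of_add_eq_zero_left h.symm
  -- the set of points transported TO `c` (= the `Γ₀(L)`-orbit of `c`); it is the same set along an orbit
  obtain ⟨orb, mem_orb, orb_smul, orb_spec⟩ : ∃ orb : OnePoint ℚ → Set (OnePoint ℚ),
      (∀ c, c ∈ orb c) ∧ (∀ (γ : Gamma0 L) (c), orb (mapGL ℚ (γ : SL(2, ℤ)) • c) = orb c) ∧
      ∀ c r, r ∈ orb c → ∃ γ : Gamma0 L, mapGL ℚ (γ : SL(2, ℤ)) • r = c := by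
    refine ⟨fun c ↦ {r | ∃ γ : Gamma0 L, mapGL ℚ (γ : SL(2, ℤ)) • r = c}, fun c ↦ ⟨1, gamma0_one_smul c⟩,
      fun γ c ↦ ?_, fun c r hr ↦ hr⟩
    ext r
    constructor
    · rintro ⟨γ', h⟩
      refine ⟨γ⁻¹ * γ', ?_⟩
      rw [gamma0_mul_smul, h, gamma0_inv_smul_smul]
    · rintro ⟨γ', h⟩
      exact ⟨γ * γ', by rw [gamma0_mul_smul, h]⟩
  -- an orbit representative, constant along orbits
  obtain ⟨rep, rep_mem, rep_smul⟩ : ∃ rep : OnePoint ℚ → OnePoint ℚ,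
      (∀ c, rep c ∈ orb c) ∧ ∀ (γ : Gamma0 L) (c), rep (mapGL ℚ (γ : SL(2, ℤ)) • c) = rep c := by
    refine ⟨fun c ↦ Classical.epsilon (fun r ↦ r ∈ orb c), fun c ↦ Classical.epsilon_spec ⟨c, mem_orb c⟩,
      fun γ c ↦ ?_⟩
    show Classical.epsilon (fun r ↦ r ∈ orb (mapGL ℚ (γ : SL(2, ℤ)) • c)) = Classical.epsilon (fun r ↦ r ∈ orb c)
    rw [orb_smul]
  -- a transporter `γ_c · rep c = c`
  obtain ⟨tr, tr_spec⟩ : ∃ tr : OnePoint ℚ → Gamma0 L, ∀ c, mapGL ℚ (tr c : SL(2, ℤ)) • rep c = c :=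
    ⟨fun c ↦ Classical.choose (orb_spec c (rep c) (rep_mem c)),
      fun c ↦ Classical.choose_spec (orb_spec c (rep c) (rep_mem c))⟩
  -- `e(c) := φ(γ_c)` satisfies `e(γ c) = e(c) + φ(γ)`
  have e_smul : ∀ (γ : Gamma0 L) (c : OnePoint ℚ), φ (tr (mapGL ℚ (γ : SL(2, ℤ)) • c)) = φ (tr c) + φ γ := by
    intro γ c
    set c' := mapGL ℚ (γ : SL(2, ℤ)) • c with hc'
    -- `(tr c')⁻¹ γ (tr c)` fixes `rep c`
    have h1 : mapGL ℚ (tr c' : SL(2, ℤ)) • rep c = c' := by rw [← rep_smul γ c]; exact tr_spec c'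
    have hfix : mapGL ℚ (((tr c')⁻¹ * (γ * tr c) : Gamma0 L) : SL(2, ℤ)) • rep c = rep c := by
      rw [gamma0_mul_smul, gamma0_mul_smul, tr_spec c, ← hc']
      have h3 : mapGL ℚ (((tr c')⁻¹ : Gamma0 L) : SL(2, ℤ)) • mapGL ℚ (tr c' : SL(2, ℤ)) • rep c = rep c :=
        gamma0_inv_smul_smul (tr c') (rep c)
      rwa [h1] at h3
    have h0 := hpar _ _ hfix
    rw [hφ, hφ, φ_inv] at h0
    have h2 := neg_add_eq_zero.mp h0
    rw [h2, add_comm]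
  refine ⟨fun a b ↦ φ (tr b) - φ (tr a), fun a b c ↦ ?_, fun γ a b ↦ ?_, fun γ ↦ ?_⟩
  · show φ (tr b) - φ (tr a) + (φ (tr c) - φ (tr b)) = φ (tr c) - φ (tr a)
    abel
  · show φ (tr (mapGL ℚ (γ : SL(2, ℤ)) • b)) - φ (tr (mapGL ℚ (γ : SL(2, ℤ)) • a)) = φ (tr b) - φ (tr a)
    rw [e_smul, e_smul]
    abel
  · show φ (tr (mapGL ℚ (γ : SL(2, ℤ)) • OnePoint.infty)) - φ (tr OnePoint.infty) = φ γ
    rw [e_smul, add_sub_cancel_left]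

end Lift

end Summit.BirchSwinnertonDyer.BirchSwinnertonDyer.Theorems.ManinLocalTwoThree
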